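import Literature.NumberTheory.GaloisCohomology.Howard2004.PiAdicRefinementCartesianProofs
import Literature.NumberTheory.GaloisCohomology.Howard2004.CohomologyMapBijectiveTransportProofs
import Literature.NumberTheory.GaloisCohomology.Howard2004.PrincipalArtinianDivisibilityProofs
import Literature.NumberTheory.EllipticCurves.TowerLocalH1CartesianProofs
import Literature.NumberTheory.GaloisRepresentations.LocalGlobalCohomologyFiniteProofs
import HarnessLib

/-!
# Howard's H.3 for a saturated `p`-adic level condition at a finite place, over the level ring, from the
# `π`-adic refinement (theorems only; no definition, no named fact, no `sorry`)

B. Howard, *The Heegner point Kolyvagin system*, Compositio Math. 140 (2004) (arXiv:1202.6340), H.3 (p. 7 L65–67) for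
`F_𝔮` (Def. 3.1.2; p. 16 L1–3).  The tree states H.3 VERBATIM over the level ring `R_k` (`Howard2004.IsCartesianOnQuotAt
(T.ρ k) (Rk k) v ((t k).cond v)`: all quotient presentations `T^{(k)} ↠ T^{(k)}/I` by ideals of `R_k`, all injective
`Quot`-morphisms).  This file discharges it for an abstract `PiRefinementDatum` `D` over `R` (the DVR `S_𝔮`), a level
ring `A` (`R`-algebra acting compatibly on `T^{(k)} = N k`, local, principal Artinian of length `e_k = mk`, `𝔪_A =
(algebraMap π)`, `T^{(k)}` free over `A`) and a finite place `v`, for the level condition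
`L = Tower.levelCondition (H¹(red)) p C^H k` of the `p`-adic local tower with cores `C^H`, GIVEN: `π`-adic cores `C^G`
compatible with `C^H` (`hCG`, `hCPG`), the tower-internal cartesian identity on the refinement (`hcartG`; x10b-p1-w7's
turnkey `Tower.comap_map_levelCondition_eq_of_exact_smul` on `D.map`), and `A`-stability of `L` (`hL`, Howard's «local
conditions are `R`-submodules»).  Chain of reductions (all in the tree):

1. `isCartesianOnQuotAt_of_forall_pow` (p650910): reduce to ideals `(π_A^i) ⊆ (π_A^j)`, `1 ≤ i ≤ j ≤ mk`, and morphisms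
   `g` with `g ∘ π_I = π_A^{j-i} · π_J`;
2. `propagate_eq_comap_iff_of_isQuotientBy` (p650910): move to the CANONICAL presentations `modIdeal (D.ρ k) _ (π_A^i)`
   with `g₀ = mapQ (π_A^{j-i} •)`;
3. `map_cohomologyMap_eq_comap_iff_of_bijective` (`CohomologyMapBijectiveTransportProofs`): move, along the equivariant
   additive bijections `β_i : T^{(k)}/π_A^i T^{(k)} → D.Level i` induced by `D.proj`, to the `π`-adic host presentations
   `(D.Level i, D.proj)` with the datum's `D.map i j`;
4. `PiRefinementDatum.map_projH_levelCondition_eq_comap` (`PiAdicRefinementCartesianProofs`): the identity there.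

Main result **`PiRefinementDatum.isCartesianOnQuotAt_levelCondition`**.  Cell `pub/bsd-print-x9`, shared μ-item of rows
9/10 (D1 road, `SatisfiesH.h3`); seat `bsd-line-x10b-p1-w6`.  No statement about elliptic curves or Selmer groups is made;
BSD is not proved by any of this.

References: [Howard2004HeegnerKolyvagin] Def. 1.1.1–1.1.3, Rem. 1.1.4, H.3, §1.6, Def. 3.1.2 (arXiv p. 5, p. 7 L65–67, p. 12,
p. 15–16); [MazurRubinMemoirs2004] Lemma 3.7.1; [SerreGaloisCohomology1997] I §2.2.
-/

set_option autoImplicit false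

noncomputable section

open Function NumberField IsDedekindDomain Field
open scoped NumberField ContRepresentation Classical Pointwise

namespace Literature.NumberTheory.GaloisCohomology.Howard2004

open Literature.NumberTheory.GaloisRepresentations
open Literature.NumberTheory.GaloisRepresentations.DiscreteGaloisModule
open Literature.NumberTheory.EllipticCurves

namespace PiRefinementDatum

variable {K : Type} [Field K] [NumberField K] {R : Type} [CommRing R] {N : ℕ → Type}
  [∀ k, AddCommGroup (N k)] [∀ k, Module R (N k)] [∀ k, TopologicalSpace (N k)] [∀ k, DiscreteTopology (N k)]
  (D : PiRefinementDatum K R N) (v : HeightOneSpectrum (𝓞 K))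
  {A : Type} [CommRing A] [Algebra R A] {k : ℕ} [Module A (N k)] [IsScalarTower R A (N k)]
  (hlinA : (D.ρ k).IsScalarLinear A)

/-! ## §1 The level-ring presentations `T^{(k)}/π_A^i T^{(k)}` and their bijections onto the host levels -/

omit [NumberField K] in
/-- `(π_A^i) · T^{(k)}` as an `A`-submodule is contained in `ker (proj : T^{(k)} → Level i)` (`= π^i · T^{(k)}` over
`R`; the two `•⊤`'s agree along the scalar tower). [cite: Howard2004HeegnerKolyvagin, Def. 1.1.3 and Rem. 1.2.4 (iii) (arXiv p. 5 L93–99, p. 7 L19–27)] -/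
theorem smul_top_restrictScalars_le_ker_proj {i : ℕ} (hi : D.host i ≤ k) :
    (Ideal.span {algebraMap R A D.π ^ i} • (⊤ : Submodule A (N k))).restrictScalars R ≤ LinearMap.ker (D.proj hi) := by
  intro x hx
  rw [D.ker_proj hi, piPow, mem_span_singleton_smul_top_iff_of_isScalarTower (A := A), map_pow]
  exact hx

/-- **The bijection `β_i : T^{(k)}/π_A^iT^{(k)} → Level i`** induced by `D.proj` (an `R`-linear map on the quotient by
the `A`-submodule, read through `restrictScalars`). [cite: Howard2004HeegnerKolyvagin, Def. 1.1.3 (arXiv p. 5 L93–99: T/IT up to isomorphism)] -/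
abbrev levelBridge {i : ℕ} (hi : D.host i ≤ k) :
    (N k ⧸ (Ideal.span {algebraMap R A D.π ^ i} • (⊤ : Submodule A (N k))).restrictScalars R) →ₗ[R] D.Level i :=
  ((Ideal.span {algebraMap R A D.π ^ i} • (⊤ : Submodule A (N k))).restrictScalars R).liftQ (D.proj hi)
    (D.smul_top_restrictScalars_le_ker_proj hi)

omit [NumberField K] in
/-- `β_i [x] = proj x`. [cite: Howard2004HeegnerKolyvagin, Def. 1.1.3 (arXiv p. 5 L93–99)] -/
theorem levelBridge_mk {i : ℕ} (hi : D.host i ≤ k) (x : N k) :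
    D.levelBridge (A := A) hi (Submodule.Quotient.mk x) = D.proj hi x :=
  Submodule.liftQ_apply _ _ x

omit [NumberField K] in
/-- `β_i` is bijective. [cite: Howard2004HeegnerKolyvagin, Def. 1.1.3 (arXiv p. 5 L93–99)] -/
theorem levelBridge_bijective {i : ℕ} (hi : D.host i ≤ k) : Bijective (D.levelBridge (A := A) hi) := by
  constructor
  · intro x y hxy
    induction x using Submodule.Quotient.induction_on with
    | _ x =>
      induction y using Submodule.Quotient.induction_on with
      | _ y =>
        rw [levelBridge_mk, levelBridge_mk, ← sub_eq_zero, ← map_sub, ← LinearMap.mem_ker, D.ker_proj hi, piPow,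
          mem_span_singleton_smul_top_iff_of_isScalarTower (A := A), map_pow] at hxy
        exact (Submodule.Quotient.eq _).mpr hxy
  · intro y
    obtain ⟨x, rfl⟩ := D.proj_surjective hi y
    exact ⟨Submodule.Quotient.mk x, D.levelBridge_mk hi x⟩

/-- `β_i` is `Γ_K`-equivariant for the `modIdeal` action on the source. [cite: Howard2004HeegnerKolyvagin, Def. 1.1.3 (arXiv p. 5 L93–99)] -/
theorem levelBridge_equivariant {i : ℕ} (hi : D.host i ≤ k) (σ : absoluteGaloisGroup K)
    (x : N k ⧸ (Ideal.span {algebraMap R A D.π ^ i} • (⊤ : Submodule A (N k)))) :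
    (D.levelBridge (A := A) hi).toAddMonoidHom (modIdeal (D.ρ k) hlinA (Ideal.span {algebraMap R A D.π ^ i}) σ x) =
      D.levelRep i σ ((D.levelBridge (A := A) hi).toAddMonoidHom x) := by
  induction x using Submodule.Quotient.induction_on with
  | _ x =>
    rw [modIdeal_apply_mk]
    change D.levelBridge (A := A) hi (Submodule.Quotient.mk _) =
      D.levelRep i σ (D.levelBridge (A := A) hi (Submodule.Quotient.mk x))
    rw [levelBridge_mk, levelBridge_mk]
    exact (D.isQuotientBy_levelRep hi).equivariant σ x

omit [NumberField K] in
/-- **`map i j ∘ β_i = β_j ∘ (×π_A^{j-i})`** on the level-ring quotients (`map_proj` and `algebraMap_smul`).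
[cite: Howard2004HeegnerKolyvagin, Def. 1.1.3 (arXiv p. 5 L95–97)] -/
theorem map_levelBridge {i j : ℕ} (hi : D.host i ≤ k) (hj : D.host j ≤ k)
    (g : (N k ⧸ (Ideal.span {algebraMap R A D.π ^ i} • (⊤ : Submodule A (N k)))) →ₗ[A]
      (N k ⧸ (Ideal.span {algebraMap R A D.π ^ j} • (⊤ : Submodule A (N k)))))
    (hg : ∀ x : N k, g (Submodule.Quotient.mk x) = (algebraMap R A D.π ^ (j - i)) • Submodule.Quotient.mk x)
    (y : N k ⧸ (Ideal.span {algebraMap R A D.π ^ i} • (⊤ : Submodule A (N k)))) :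
    D.map i j ((D.levelBridge (A := A) hi).toAddMonoidHom y) = (D.levelBridge (A := A) hj).toAddMonoidHom (g y) := by
  induction y using Submodule.Quotient.induction_on with
  | _ x =>
    change D.map i j (D.levelBridge (A := A) hi (Submodule.Quotient.mk x)) =
      D.levelBridge (A := A) hj (g (Submodule.Quotient.mk x))
    rw [hg, ← Submodule.Quotient.mk_smul]
    have e2 : D.levelBridge (A := A) hj (Submodule.Quotient.mk ((algebraMap R A D.π ^ (j - i)) • x)) =
        D.proj hj ((algebraMap R A D.π ^ (j - i)) • x) :=
      D.levelBridge_mk (A := A) hj _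
    refine (congrArg (D.map i j) (D.levelBridge_mk (A := A) hi x)).trans ?_
    refine Eq.trans ?_ e2.symm
    rw [D.map_proj i j hi hj, ← map_pow, algebraMap_smul, map_smul]

/-! ## §2 H.3 for the level condition of the `p`-adic tower, over the level ring -/

variable (p : ℕ) {m : ℕ} (CP : ∀ j, AddSubgroup (galoisCohomology (GaloisRep.toLocal v (D.ρ j)) 1))

/-- **H.3 (Howard), for the saturated level-`k` condition of a `p`-adic local tower, over the level ring `A`.**
With the `π`-adic refinement data above and `A` local, principal Artinian of length `mk`, `𝔪_A = (algebraMap π)`,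
`T^{(k)}` free over `A` with `A`-linear action, and the level condition `A`-stable: `F` is cartesian on `Quot(T^{(k)})` at
the finite place `v` in the verbatim sense of `IsCartesianOnQuotAt`.
[cite: Howard2004HeegnerKolyvagin, H.3 with Def. 1.1.2–1.1.3, Rem. 1.1.4 and Def. 3.1.2 (arXiv p. 7 L65–67, p. 5 L88–105, p. 16 L1–3)]
[cite: MazurRubinMemoirs2004, Lemma 3.7.1] -/
theorem isCartesianOnQuotAt_levelCondition [IsLocalRing A] [Module.Free A (N k)]
    (hm : 1 ≤ m) (hhost : ∀ j, D.host (m * j) ≤ j) (he : ∀ j, D.e j = m * j)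
    (CG : ∀ a, AddSubgroup (galoisCohomology (GaloisRep.toLocal v (D.levelRep a)) 1))
    (hCG : ∀ a b, b ≤ a → ∀ w ∈ CG a, D.mapH v a b w ∈ CG b)
    (hCPG : ∀ j, (CP j).map (D.projH v (hhost j)) = CG (m * j))
    (hcartG : ∀ i j, i ≤ j → (Tower.levelCondition (fun a ↦ D.mapH v (a + 1) a) p CG j).comap (D.mapH v i j) =
      Tower.levelCondition (fun a ↦ D.mapH v (a + 1) a) p CG i)
    (hmaxA : IsLocalRing.maximalIdeal A = Ideal.span {algebraMap R A D.π})
    (hPA : IsPrincipalArtinianOfLength A (m * k))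
    (hL : ∀ a : A, (Tower.levelCondition (fun j ↦ D.redH v (Nat.le_succ j)) p CP k).map
      (galoisCohomology.scalarMapH1 (GaloisRep.toLocal v (D.ρ k)) (hlinA.restrictField _) a) ≤
      Tower.levelCondition (fun j ↦ D.redH v (Nat.le_succ j)) p CP k) :
    IsCartesianOnQuotAt (D.ρ k) A (Sum.inr v) (Tower.levelCondition (fun j ↦ D.redH v (Nat.le_succ j)) p CP k) := by
  refine isCartesianOnQuotAt_of_forall_pow (D.ρ k) hlinA hmaxA hPA (Sum.inr v) _ hL ?_
  intro i j hi hij hjn NI NJ _ _ _ _ _ _ _ _ ρI πI ρJ πJ hI hJ g hg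
  -- host bounds for `i ≤ j ≤ mk`
  have hik : D.host i ≤ k := (D.host_mono (hij.trans hjn)).trans (hhost k)
  have hjk : D.host j ≤ k := (D.host_mono hjn).trans (hhost k)
  -- Step 2: the canonical presentations `modIdeal` with `g₀ = mapQ (π_A^{j-i} •)`
  set πA : A := algebraMap R A D.π with hπA
  have hle : Ideal.span {πA ^ i} • (⊤ : Submodule A (N k)) ≤
      (Ideal.span {πA ^ j} • (⊤ : Submodule A (N k))).comap ((πA ^ (j - i)) • LinearMap.id) := by
    rw [Submodule.ideal_span_singleton_smul, Submodule.ideal_span_singleton_smul]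
    rintro _ ⟨x, -, rfl⟩
    rw [Submodule.mem_comap, LinearMap.smul_apply, LinearMap.id_apply]
    change πA ^ (j - i) • (πA ^ i • x) ∈ πA ^ j • (⊤ : Submodule A (N k))
    rw [← mul_smul, ← pow_add, Nat.sub_add_cancel hij]
    exact Submodule.smul_mem_pointwise_smul _ _ _ Submodule.mem_top
  set g₀ := Submodule.mapQ _ _ ((πA ^ (j - i)) • (LinearMap.id : N k →ₗ[A] N k)) hle with hg₀
  have hg₀c : ∀ x : N k, g₀ (Submodule.Quotient.mk x) = πA ^ (j - i) • Submodule.Quotient.mk x := fun x => by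
    rw [hg₀, Submodule.mapQ_apply, LinearMap.smul_apply, LinearMap.id_apply, Submodule.Quotient.mk_smul]
  have hQI := isQuotientBy_modIdeal (D.ρ k) hlinA (Ideal.span {πA ^ i})
  have hQJ := isQuotientBy_modIdeal (D.ρ k) hlinA (Ideal.span {πA ^ j})
  have hlinQJ := isScalarLinear_modIdeal (D.ρ k) hlinA (Ideal.span {πA ^ j})
  have hg₀e : ∀ (σ : absoluteGaloisGroup K) (x : N k ⧸ (Ideal.span {πA ^ i} • (⊤ : Submodule A (N k)))),
      g₀.toAddMonoidHom (modIdeal (D.ρ k) hlinA (Ideal.span {πA ^ i}) σ x) =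
        modIdeal (D.ρ k) hlinA (Ideal.span {πA ^ j}) σ (g₀.toAddMonoidHom x) := fun σ x => by
    induction x using Submodule.Quotient.induction_on with
    | _ x =>
      change g₀ (modIdeal (D.ρ k) hlinA (Ideal.span {πA ^ i}) σ (Submodule.Quotient.mk x)) =
        modIdeal (D.ρ k) hlinA (Ideal.span {πA ^ j}) σ (g₀ (Submodule.Quotient.mk x))
      rw [modIdeal_apply_mk, hg₀c, hg₀c, hlinQJ σ]
      exact congrArg _ (modIdeal_apply_mk (D.ρ k) hlinA (Ideal.span {πA ^ j}) σ x).symm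
  refine (propagate_eq_comap_iff_of_isQuotientBy hI hQI hJ hQJ (Sum.inr v) _ (πA ^ (j - i))
    g.toAddMonoidHom (fun σ x => hg.equivariant σ x) (fun x => hg.comp_eq x)
    g₀.toAddMonoidHom hg₀e (fun x => hg₀c x)).mpr ?_
  -- Step 3: transport to the host presentations `(Level i, proj)` along `β`
  refine (map_cohomologyMap_eq_comap_iff_of_bijective ((D.ρ k).toLocal (Sum.inr v))
    ((modIdeal (D.ρ k) hlinA (Ideal.span {πA ^ i})).toLocal (Sum.inr v))
    ((modIdeal (D.ρ k) hlinA (Ideal.span {πA ^ j})).toLocal (Sum.inr v))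
    ((D.levelRep i).toLocal (Sum.inr v)) ((D.levelRep j).toLocal (Sum.inr v))
    (Submodule.mkQ (Ideal.span {πA ^ i} • (⊤ : Submodule A (N k)))).toAddMonoidHom (fun σ x => hQI.equivariant _ x)
    (Submodule.mkQ (Ideal.span {πA ^ j} • (⊤ : Submodule A (N k)))).toAddMonoidHom (fun σ x => hQJ.equivariant _ x)
    g₀.toAddMonoidHom (fun σ x => hg₀e _ x)
    (D.proj hik).toAddMonoidHom (fun σ x => D.proj_equivariant_toLocal v hik σ x)
    (D.proj hjk).toAddMonoidHom (fun σ x => D.proj_equivariant_toLocal v hjk σ x)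
    (D.map i j).toAddMonoidHom (fun σ x => D.map_equivariant_toLocal v i j σ x)
    (D.levelBridge (A := A) hik).toAddMonoidHom (fun σ x => D.levelBridge_equivariant hlinA hik _ x)
    (D.levelBridge_bijective (A := A) hik)
    (D.levelBridge (A := A) hjk).toAddMonoidHom (fun σ x => D.levelBridge_equivariant hlinA hjk _ x)
    (D.levelBridge_bijective (A := A) hjk)
    (fun x => D.levelBridge_mk (A := A) hik x) (fun x => D.levelBridge_mk (A := A) hjk x)
    (fun y => D.map_levelBridge hik hjk g₀ hg₀c y) _).mpr ?_
  -- Step 4: the identity on the refinement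
  exact D.map_projH_levelCondition_eq_comap v p hhost CP CG hm he hCG hCPG hcartG hij hjn hik hjk


/-! ## §3 The tower-internal identity on the refinement from x10b-p1-w7's turnkey, and H.3 without `hcartG` -/

/-- **`hcartG` for the datum** (x10b-p1-w7's `Tower.comap_map_levelCondition_eq_of_exact_smul` instantiated on the
two-index family `D.map` at the place `v`): for finite levels, `π`-adic cores `C^G` stable under the scalar action,
and `p ∈ (π)`, `(L^G_j).comap H¹(map i j) = L^G_i` for all `i ≤ j`.
[cite: Howard2004HeegnerKolyvagin, H.3 and Def. 3.1.2 (arXiv p. 7 L65–67, p. 16 L1–3)] [cite: MazurRubinMemoirs2004, Lemma 3.7.1] -/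
theorem comap_mapH_levelCondition_eq [∀ a, Finite (D.Level a)] (hp : ((p : ℕ) : R) ∈ Ideal.span {D.π})
    (CG : ∀ a, AddSubgroup (galoisCohomology (GaloisRep.toLocal v (D.levelRep a)) 1))
    (hCGs : ∀ a (r : R) (y : galoisCohomology (GaloisRep.toLocal v (D.levelRep a)) 1), y ∈ CG a →
      galoisCohomology.scalarMapH1 (GaloisRep.toLocal v (D.levelRep a))
        ((D.isScalarLinear_levelRep a).restrictField _) r y ∈ CG a)
    (i j : ℕ) (hij : i ≤ j) :
    (Tower.levelCondition (fun a ↦ D.mapH v (a + 1) a) p CG j).comap (D.mapH v i j) =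
      Tower.levelCondition (fun a ↦ D.mapH v (a + 1) a) p CG i := by
  haveI : ∀ a, Finite (galoisCohomology (GaloisRep.toLocal v (D.levelRep a)) 1) := fun a ↦
    finite_galoisCohomology_one_adicCompletion v (GaloisRep.toLocal v (D.levelRep a))
  obtain ⟨d, rfl⟩ := Nat.exists_eq_add_of_le hij
  exact Tower.comap_map_levelCondition_eq_of_exact_smul (fun a ↦ GaloisRep.toLocal v (D.levelRep a))
    (fun a b ↦ localIntertwining (D.levelRep a) (D.levelRep b) v (D.map a b).toAddMonoidHom
      (D.map_equivariant_toLocal v a b))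
    (fun a ↦ (D.isScalarLinear_levelRep a).restrictField _) (fun a w ↦ D.map_self a w)
    (fun a b c hcb hba w ↦ D.map_map_of_le hcb hba w) (fun a b hab w ↦ D.map_map_succ hab w)
    (fun ℓ n ↦ D.map_injective ℓ n) (fun ℓ n ↦ D.map_surjective ℓ n) (fun ℓ n y ↦ D.map_eq_zero_iff ℓ n y)
    (fun a b r w ↦ (D.map a b).map_smul r w) p D.π hp (fun ℓ n w ↦ D.map_map_smul ℓ n w)
    (fun j w ↦ D.pow_smul_level_eq_zero j w) CG hCGs i d

/-- **H.3 (Howard) for the saturated level-`k` condition of a `p`-adic local tower over the level ring**, with the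
tower-internal identity supplied by x10b-p1-w7's turnkey: hypotheses = finiteness of the refinement levels, `p ∈ (π)`,
`π`-adic cores compatible with the `p`-adic ones (`hCG`, `hCPG`) and scalar-stable (`hCGs`), the level ring data, and
`A`-stability of the condition. [cite: Howard2004HeegnerKolyvagin, H.3 with Def. 1.1.2–1.1.3, Rem. 1.1.4 and Def. 3.1.2 (arXiv p. 7 L65–67, p. 5 L88–105, p. 16 L1–3)]
[cite: MazurRubinMemoirs2004, Lemma 3.7.1] -/
theorem isCartesianOnQuotAt_levelCondition_of_finite [IsLocalRing A] [Module.Free A (N k)] [∀ a, Finite (D.Level a)]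
    (hm : 1 ≤ m) (hhost : ∀ j, D.host (m * j) ≤ j) (he : ∀ j, D.e j = m * j)
    (hp : ((p : ℕ) : R) ∈ Ideal.span {D.π})
    (CG : ∀ a, AddSubgroup (galoisCohomology (GaloisRep.toLocal v (D.levelRep a)) 1))
    (hCG : ∀ a b, b ≤ a → ∀ w ∈ CG a, D.mapH v a b w ∈ CG b)
    (hCGs : ∀ a (r : R) (y : galoisCohomology (GaloisRep.toLocal v (D.levelRep a)) 1), y ∈ CG a →
      galoisCohomology.scalarMapH1 (GaloisRep.toLocal v (D.levelRep a))
        ((D.isScalarLinear_levelRep a).restrictField _) r y ∈ CG a)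
    (hCPG : ∀ j, (CP j).map (D.projH v (hhost j)) = CG (m * j))
    (hmaxA : IsLocalRing.maximalIdeal A = Ideal.span {algebraMap R A D.π})
    (hPA : IsPrincipalArtinianOfLength A (m * k))
    (hL : ∀ a : A, (Tower.levelCondition (fun j ↦ D.redH v (Nat.le_succ j)) p CP k).map
      (galoisCohomology.scalarMapH1 (GaloisRep.toLocal v (D.ρ k)) (hlinA.restrictField _) a) ≤
      Tower.levelCondition (fun j ↦ D.redH v (Nat.le_succ j)) p CP k) :
    IsCartesianOnQuotAt (D.ρ k) A (Sum.inr v) (Tower.levelCondition (fun j ↦ D.redH v (Nat.le_succ j)) p CP k) :=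
  D.isCartesianOnQuotAt_levelCondition v hlinA p CP hm hhost he CG hCG hCPG
    (fun i j hij ↦ D.comap_mapH_levelCondition_eq v p hp CG hCGs i j hij) hmaxA hPA hL

end PiRefinementDatum

end Literature.NumberTheory.GaloisCohomology.Howard2004

end
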